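import Literature.Computability.Complexity.GraphCanonizationProgramFPFrames
import Literature.Computability.Complexity.GraphCanonizationMachineGood
import HarnessLib

/-!
# The canoniser as a list program: the configurations of the run have polynomial size

From the invariant of `GraphCanonizationMachineGood.lean` (every configuration of the run is short
and consists of good frames) and the colour bound of colour refinement (`crRefine_le`), the code of
every configuration of the list machine along the run from the root state has length at most
`5646 (k + 1)⁵` (`length_rawE_frameE_runL_le`) — the size hypothesis of the iteration combinator
`CodeFP.iterateInv` in the final assembly.

## References

* S. Arora, B. Barak, *Computational Complexity: A Modern Approach*, CUP 2009, §1.3. [AroraBarakCC2009]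
* B. Laubner, PhD thesis, HU Berlin 2011, doi:10.18452/16335, §3.4. [Laubner2011]
-/

namespace Literature.Computability.Complexity

open Literature.Combinatorics.SimpleGraph Finset ColourRefinementScheme CodeFP CGCanon

open scoped Classical

noncomputable section

namespace CGProg

variable {k : ℕ}

/-! ### Colour refinement has small colours -/

/-- The colours of `crRefine` are `< k`. [folklore] -/
theorem crRefine_lt (G : SimpleGraph (Fin k)) (W : Finset (Fin k)) (c : Fin k → ℕ) (v : Fin k) : crRefine G W c v < k := by
  cases k with
  | zero => exact v.elim0
  | succ k =>
    unfold crRefine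
    rw [ocrIter_succ]
    exact (ocrStep_lt_card (G := within G W) v).trans_eq (Fintype.card_fin _)

/-- Hence `≤ k`, in the form the invariant wants. [folklore] -/
theorem crRefiner_refine_le (G : SimpleGraph (Fin k)) (W : Finset (Fin k)) (c : Fin k → ℕ) (v : Fin k) :
    (crRefiner k).refine G W c v ≤ k := (crRefine_lt G W c v).le

/-! ### Lengths of the field codes -/

/-- A raw list of at most `k` numerals `≤ k`. [folklore] -/
theorem length_rawE_natE_le {l : List ℕ} (hl : l.length ≤ k) (h : ∀ a ∈ l, a ≤ k) : (rawE natE l).length ≤ k * (2 * k + 2) :=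
  (length_rawE_le_of_forall fun a ha => (length_natE_le a).trans (h a ha)).trans (Nat.mul_le_mul_right _ hl)

/-- A raw list of at most `k` vertex numbers. [folklore] -/
theorem length_rawE_map_val_le {l : List (Fin k)} (hl : l.length ≤ k) : (rawE natE (l.map Fin.val)).length ≤ k * (2 * k + 2) :=
  length_rawE_natE_le (by rw [List.length_map]; exact hl) fun a ha => by
    obtain ⟨v, -, rfl⟩ := List.mem_map.1 ha; exact v.isLt.le

/-- The colour list of a colouring with colours `≤ k`. [folklore] -/
theorem length_rawE_colOf_le {c : Fin k → ℕ} (hc : ∀ v, c v ≤ k) : (rawE natE (colOf c)).length ≤ k * (2 * k + 2) :=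
  length_rawE_natE_le (length_colOf c).le fun a ha => by
    unfold colOf at ha; obtain ⟨v, rfl⟩ := List.mem_ofFn.1 ha; exact hc v

/-- A raw list of at most `k` masks. [folklore] -/
theorem length_rawE_map_maskOf_le {l : List (Finset (Fin k))} (hl : l.length ≤ k) : (rawE strE (l.map maskOf)).length ≤ k * (2 * k + 2) :=
  (length_rawE_le_of_forall (B := k) fun a ha => by
    obtain ⟨W, -, rfl⟩ := List.mem_map.1 ha; exact (length_maskOf W).le).trans
    (Nat.mul_le_mul_right _ (by rw [List.length_map]; exact hl))

/-- The rows of the code of an ordering of length `≤ k`. [folklore] -/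
theorem length_rawE_rows_le (G : SimpleGraph (Fin k)) {ord : List (Fin k)} (h : ord.length ≤ k) :
    (rawE strE (ord.map fun u => ord.map fun v => decide (G.Adj u v))).length ≤ k * (2 * k + 2) :=
  (length_rawE_le_of_forall (B := k) fun a ha => by
    obtain ⟨u, -, rfl⟩ := List.mem_map.1 ha; change (List.map _ ord).length ≤ k; rw [List.length_map]; exact h).trans
    (Nat.mul_le_mul_right _ (by rw [List.length_map]; exact h))

/-- The data of a good candidate is short: `≤ 22 (k + 1)²`. [folklore] -/
theorem length_candTE_le (G : SimpleGraph (Fin k)) {c : Fin k → ℕ} (hc : ∀ v, c v ≤ k) {b : Cand k} (hb : GoodCand G c b) :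
    (candTE (dataOfCand (candL b))).length ≤ 22 * (k + 1) ^ 2 := by
  obtain ⟨hlen, hx, hcode⟩ := hb
  have hrows := length_rawE_rows_le G (ord := (ofLex (ofLex b).2).2) hlen
  have hcols : (rawE natE ((ofLex (ofLex b).2).2.map c)).length ≤ k * (2 * k + 2) :=
    length_rawE_natE_le (by rw [List.length_map]; exact hlen) fun a ha => by obtain ⟨v, -, rfl⟩ := List.mem_map.1 ha; exact hc v
  have hord := length_rawE_map_val_le hlen
  have hxl := (length_natE_le (ofLex (ofLex b).2).1).trans hx.le
  have e : dataOfCand (candL b) = ((((ofLex (ofLex b).2).2.map fun u => (ofLex (ofLex b).2).2.map fun v => decide (G.Adj u v)),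
      (ofLex (ofLex b).2).2.map c), ((ofLex (ofLex b).2).1, (ofLex (ofLex b).2).2.map Fin.val)) := by
    simp only [dataOfCand, candL, ofLex_toLex, hcode, code]
  rw [e, length_pairE_mk, length_pairE_mk, length_pairE_mk]
  linarith [Nat.zero_le (k ^ 2)]

/-- The finished parts of a good section frame are short: `≤ 6 (k + 1)³`. [folklore] -/
theorem length_rawE_done_le {done : List (Finset (Fin k) × List (Fin k))} (hlen : done.length ≤ k) (h : ∀ p ∈ done, p.2.length ≤ k) :
    (rawE (pairE strE (rawE natE)) (done.map fun p => (maskOf p.1, p.2.map Fin.val))).length ≤ 6 * (k + 1) ^ 3 := by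
  have hitem : ∀ a ∈ done.map (fun p => (maskOf p.1, p.2.map Fin.val)), (pairE strE (rawE natE) a).length ≤ 2 * k + 2 + k * (2 * k + 2) := by
    intro a ha
    obtain ⟨p, hp, rfl⟩ := List.mem_map.1 ha
    rw [length_pairE_mk, show (strE (maskOf p.1)).length = k from length_maskOf p.1]
    have := length_rawE_map_val_le (h p hp)
    omega
  refine (length_rawE_le_of_forall hitem).trans ?_
  rw [List.length_map]
  calc done.length * (2 * (2 * k + 2 + k * (2 * k + 2)) + 2) ≤ k * (2 * (2 * k + 2 + k * (2 * k + 2)) + 2) := Nat.mul_le_mul_right _ hlen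
    _ ≤ 6 * (k + 1) ^ 3 := by linarith [Nat.zero_le (k ^ 2), Nat.zero_le (k ^ 3)]

/-- The code of a record from bounds on its ten fields. [folklore] -/
theorem length_ftupleE_le (t : FTuple) {B : ℕ} (h1 : (natE t.1).length ≤ B) (h2 : t.2.1.length ≤ B) (h3 : (rawE natE t.2.2.1).length ≤ B)
    (h4 : (optE natE t.2.2.2.1).length ≤ B) (h5 : (rawE natE t.2.2.2.2.1).length ≤ B) (h6 : (optE candTE t.2.2.2.2.2.1).length ≤ B)
    (h7 : (optE strE t.2.2.2.2.2.2.1).length ≤ B) (h8 : (rawE strE t.2.2.2.2.2.2.2.1).length ≤ B)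
    (h9 : (rawE (pairE strE (rawE natE)) t.2.2.2.2.2.2.2.2.1).length ≤ B) (h10 : (rawE natE t.2.2.2.2.2.2.2.2.2).length ≤ B) :
    (ftupleE t).length ≤ 20 * B + 18 := by
  obtain ⟨a1, a2, a3, a4, a5, a6, a7, a8, a9, a10⟩ := t
  simp only [length_pairE_mk] at *
  change (strE a2).length ≤ B at h2
  omega

/-- An optional numeral `< k`. [folklore] -/
theorem length_optE_map_val_le (o : Option (Fin k)) : (optE natE (o.map Fin.val)).length ≤ 2 * k + 2 := by
  cases o with
  | none => simp
  | some x => rw [Option.map_some, length_optE_some]; have := (length_natE_le x.val).trans x.isLt.le; omega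

/-- An optional mask. [folklore] -/
theorem length_optE_map_maskOf_le (o : Option (Finset (Fin k))) : (optE strE (o.map maskOf)).length ≤ 2 * k + 2 := by
  cases o with
  | none => simp
  | some W => rw [Option.map_some, length_optE_some, show (strE (maskOf W)).length = k from length_maskOf W]

/-! ### Good frames have short codes -/

/-- **A good frame has a code of length `≤ 940 (k + 1)³`.** [cite: AroraBarakCC2009, §1.3] -/
theorem length_frameE_frameL_le (G : SimpleGraph (Fin k)) {f : Frame k} (hf : GoodF G f) : (frameE (frameL f)).length ≤ 940 * (k + 1) ^ 3 := by
  have hB : ∀ {x : ℕ}, x ≤ 46 * (k + 1) ^ 3 → x ≤ 46 * (k + 1) ^ 3 := id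
  have hk1 : k * (2 * k + 2) ≤ 46 * (k + 1) ^ 3 := by linarith [Nat.zero_le (k ^ 2), Nat.zero_le (k ^ 3)]
  have hk2 : 2 * k + 2 ≤ 46 * (k + 1) ^ 3 := by linarith [Nat.zero_le (k ^ 2), Nat.zero_le (k ^ 3)]
  have hkk : k ≤ 46 * (k + 1) ^ 3 := by linarith [Nat.zero_le (k ^ 2), Nat.zero_le (k ^ 3)]
  have hk3 : (2 : ℕ) ≤ 46 * (k + 1) ^ 3 := by linarith [Nat.zero_le (k ^ 2), Nat.zero_le (k ^ 3)]
  have hk0 : (0 : ℕ) ≤ 46 * (k + 1) ^ 3 := Nat.zero_le _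
  suffices H : (ftupleE (tupleOf (frameL f))).length ≤ 20 * (46 * (k + 1) ^ 3) + 18 by
    change (ftupleE (tupleOf (frameL f))).length ≤ _; linarith [Nat.zero_le (k ^ 2), Nat.zero_le (k ^ 3)]
  rcases f with ⟨W, c, cur, xs, best⟩ | ⟨W, c, cur, todo, done⟩ | ord
  · obtain ⟨hc, hxs, hbest⟩ := hf
    refine length_ftupleE_le _ ((length_natE_le 0).trans hk0) (by simpa [tupleOf, frameL] using hkk) ?_ ?_ ?_ ?_ (by simp [tupleOf, frameL])
      (by simp [tupleOf, frameL]) (by simp [tupleOf, frameL]) (by simp [tupleOf, frameL])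
    · simpa [tupleOf, frameL] using (length_rawE_colOf_le hc).trans hk1
    · simpa [tupleOf, frameL] using (length_optE_map_val_le cur).trans hk2
    · simpa [tupleOf, frameL] using (length_rawE_map_val_le hxs).trans hk1
    · simp only [tupleOf, frameL, Option.map_map]
      cases best with
      | none => simp
      | some b =>
        rw [Option.map_some, length_optE_some]
        have := length_candTE_le G hc (hbest b rfl)
        change 2 * (candTE (dataOfCand (candL b))).length + 2 ≤ _
        linarith [Nat.zero_le (k ^ 2), Nat.zero_le (k ^ 3)]
  · obtain ⟨hc, hlen, hdone⟩ := hf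
    refine length_ftupleE_le _ ((length_natE_le 1).trans (by omega)) (by simpa [tupleOf, frameL] using hkk) ?_ (by simp [tupleOf, frameL])
      (by simp [tupleOf, frameL]) (by simp [tupleOf, frameL]) ?_ ?_ ?_ (by simp [tupleOf, frameL])
    · simpa [tupleOf, frameL] using (length_rawE_colOf_le hc).trans hk1
    · simpa [tupleOf, frameL] using (length_optE_map_maskOf_le cur).trans hk2
    · simpa [tupleOf, frameL] using (length_rawE_map_maskOf_le (l := todo) (by omega)).trans hk1
    · simp only [tupleOf, frameL]
      exact (length_rawE_done_le (by omega) hdone).trans (by linarith [Nat.zero_le (k ^ 2), Nat.zero_le (k ^ 3)])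
  · refine length_ftupleE_le _ ((length_natE_le 2).trans hk3) (by simp [tupleOf, frameL]) (by simp [tupleOf, frameL]) (by simp [tupleOf, frameL])
      (by simp [tupleOf, frameL]) (by simp [tupleOf, frameL]) (by simp [tupleOf, frameL]) (by simp [tupleOf, frameL]) (by simp [tupleOf, frameL]) ?_
    simpa [tupleOf, frameL] using (length_rawE_map_val_le hf).trans hk1

/-! ### The configurations of the run -/

/-- **Every configuration of the list machine along the run from the root state has a code of
length `≤ 5646 (k + 1)⁵`.** [cite: AroraBarakCC2009, §1.3] -/
theorem length_rawE_frameE_runL_le (G : SimpleGraph (Fin k)) (col : Fin k → ℕ) (m : ℕ) :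
    (rawE frameE (runL k (adjOf G) m [classifyL k (adjOf G) (maskOf (univ : Finset (Fin k)))
      (refineL k (adjOf G) (maskOf (univ : Finset (Fin k))) (colOf col))])).length ≤ 5646 * (k + 1) ^ 5 := by
  rw [refineL_eq, classifyL_eq, show [frameL (classify G univ (crRefine G univ col))] = cfgL [classify G univ ((crRefiner k).refine G univ col)] from rfl,
    runL_cfgL]
  obtain ⟨hlen, hgood⟩ := run_good (R := crRefiner k) (G := G) (crRefiner_refine_le G) univ ((crRefiner k).refine G univ col)
    (crRefiner_refine_le G univ col) m
  unfold cfgL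
  refine (length_rawE_le_of_forall (B := 940 * (k + 1) ^ 3) fun a ha => ?_).trans ?_
  · obtain ⟨f, hf, rfl⟩ := List.mem_map.1 ha
    exact length_frameE_frameL_le G (hgood f hf)
  · rw [List.length_map]
    have hd := depth_le (k := k) univ ((crRefiner k).refine G univ col)
    calc (run (crRefiner k) G m [classify G univ ((crRefiner k).refine G univ col)]).length * (2 * (940 * (k + 1) ^ 3) + 2)
        ≤ ((k + 1) * k + 2) * (2 * (940 * (k + 1) ^ 3) + 2) := Nat.mul_le_mul_right _ (by omega)
      _ ≤ 5646 * (k + 1) ^ 5 := by linarith [Nat.zero_le (k ^ 2), Nat.zero_le (k ^ 3), Nat.zero_le (k ^ 4), Nat.zero_le (k ^ 5)]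

end CGProg

end

end Literature.Computability.Complexity
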